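import Literature.MathematicalPhysics.QuantumLattice.XYOrderDischarges
import Literature.MathematicalPhysics.QuantumLattice.SectorGroundProjContinuity

/-!
# Route `AnisotropyChord`: THEOREM V — Hellmann–Feynman (virial) monotonicity along the XXZ pencil
# (what IS monotone in `Δ` on every graph; bears on `Concavity` stmt-8150 / `ChordXY` stmt-8146)

Notation of the route: `H(Δ) = xxzHamiltonian n G J Δ` (the route takes `n = 1`, `J = −1`,
`G = torusGraph 2 M`); `H(Δ) = H(0) + Δ·(H(1) − H(0))` is an affine pencil whose slope
`H(1) − H(0) = J Σ_{xy∈E} Sᶻ_x Sᶻ_y` is the Ising part.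

**THEOREM V** (theory seat `hubbard-h0-rotor-theory-1`, cycle 3, §16; two-line variational proof,
ANY finite graph, any spin, any coupling sign, any magnetisation sector, no uniqueness needed):
for normalised sector ground states `ψ₁` of `H(Δ₁)` and `ψ₂` of `H(Δ₂)` with `Δ₁ < Δ₂`,

* `sectorGS_isingEnergy_antitone`: `Re⟨ψ₂, (H(1) − H(0)) ψ₂⟩ ≤ Re⟨ψ₁, (H(1) − H(0)) ψ₁⟩` — for the route
  (`J = −1`) the nearest-neighbour Ising correlation `Σ_E ⟨Sᶻ_xSᶻ_y⟩` of the sector ground state is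
  NON-DECREASING in the Ising coupling `Δ`;
* `sectorGS_energyAt_antitone` / `sectorGS_energyAt_monotone`: for `Δ₂ ≤ Δ⋆` (resp. `Δ⋆ ≤ Δ₁`) the
  `H(Δ⋆)`-energy of the sector ground state is non-increasing (resp. non-decreasing) from `Δ₁` to `Δ₂`;
  with `Δ⋆ = 1`, `J = −1`: the isotropic-ferromagnet energy (½ the token-graph Dirichlet form) of the
  XXZ sector ground state decreases as `Δ ↑ 1` on EVERY graph.

This is all the span `{H_XY, H_Ising}` gives for free: the route's functional
`Λ = ⟨S⁺_tot S⁻_tot⟩` (ALL pairs, the zero-momentum structure factor) is outside that span, and its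
monotonicity / concavity in `Δ` is graph-dependent (`OneMagnon.not_graphGeneral_condensate_monotone`,
`…_concave`).  Elementary; H. Tasaki, *Physics and Mathematics of Quantum Many-Body Systems* (2020)
§2.4 (XXZ model), App. A (variational principle).  No definition is introduced.
-/

set_option linter.dupNamespace false

noncomputable section

namespace Summit.HubbardSuperconductivity.HubbardSuperconductivity.Theorems.AnisotropyChord

open Matrix Complex Finset
open Literature.MathematicalPhysics.QuantumLattice

variable {Λ : Type*} [Fintype Λ] [DecidableEq Λ] (n : ℕ) (G : SimpleGraph Λ) [DecidableRel G.Adj]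

/-- **The XXZ family is an affine pencil in the anisotropy**: `H(Δ) = H(0) + Δ·(H(1) − H(0))`.
[folklore] -/
theorem xxzHamiltonian_affine (J Δ : ℝ) :
    xxzHamiltonian n G J Δ =
      xxzHamiltonian n G J 0 + ((Δ : ℝ) : ℂ) • (xxzHamiltonian n G J 1 - xxzHamiltonian n G J 0) := by
  -- `H(Δ) = H(0) + Δ · (J Σ_e SᶻSᶻ(e))`
  have key : ∀ Δ' : ℝ, xxzHamiltonian n G J Δ' = xxzHamiltonian n G J 0 +
      ((Δ' : ℝ) : ℂ) • ((J : ℂ) • ∑ e ∈ G.edgeFinset,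
        Sym2.lift ⟨fun x y => spinBond n 2 x y, fun x y => by simp only [spinBond_comm]⟩ e) := by
    intro Δ'
    unfold xxzHamiltonian
    rw [smul_comm ((Δ' : ℝ) : ℂ) ((J : ℝ) : ℂ), ← smul_add]
    congr 1
    rw [Finset.smul_sum, ← Finset.sum_add_distrib]
    refine Finset.sum_congr rfl fun e _ => ?_
    induction e using Sym2.ind with
    | h x y => simp only [Sym2.lift_mk, Complex.ofReal_zero, zero_smul, add_zero]
  have h1 : xxzHamiltonian n G J 1 - xxzHamiltonian n G J 0 =
      (J : ℂ) • ∑ e ∈ G.edgeFinset,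
        Sym2.lift ⟨fun x y => spinBond n 2 x y, fun x y => by simp only [spinBond_comm]⟩ e := by
    rw [key 1, Complex.ofReal_one, one_smul, add_sub_cancel_left]
  rw [h1]
  exact key Δ

/-- Quadratic forms along the pencil:
`Re⟨ψ, H(Δ)ψ⟩ = Re⟨ψ, H(0)ψ⟩ + Δ · Re⟨ψ, (H(1) − H(0))ψ⟩`. [folklore] -/
theorem re_form_affine (J Δ : ℝ) (ψ : TensorIndex Λ (n + 1) → ℂ) :
    (star ψ ⬝ᵥ (xxzHamiltonian n G J Δ *ᵥ ψ)).re
      = (star ψ ⬝ᵥ (xxzHamiltonian n G J 0 *ᵥ ψ)).re +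
        Δ * (star ψ ⬝ᵥ ((xxzHamiltonian n G J 1 - xxzHamiltonian n G J 0) *ᵥ ψ)).re := by
  rw [xxzHamiltonian_affine n G J Δ, add_mulVec, smul_mulVec, dotProduct_add, dotProduct_smul,
    Complex.add_re, smul_eq_mul, Complex.re_ofReal_mul]

/-- The energy of a normalised eigenvector at the sector energy is the sector energy. [folklore] -/
theorem re_form_of_sectorGS {J Δ M : ℝ} {ψ : TensorIndex Λ (n + 1) → ℂ}
    (h1 : star ψ ⬝ᵥ ψ = 1)
    (hE : xxzHamiltonian n G J Δ *ᵥ ψ =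
      ((lowestEnergyInSector n (xxzHamiltonian n G J Δ) M : ℝ) : ℂ) • ψ) :
    (star ψ ⬝ᵥ (xxzHamiltonian n G J Δ *ᵥ ψ)).re = lowestEnergyInSector n (xxzHamiltonian n G J Δ) M := by
  rw [hE, dotProduct_smul, h1, smul_eq_mul, mul_one, Complex.ofReal_re]

/-- Variational bound: the sector energy is below the energy of any normalised sector state.
[folklore] -/
theorem sectorEnergy_le_re_form {J Δ M : ℝ} {φ : TensorIndex Λ (n + 1) → ℂ}
    (hφ : φ ∈ spinZSector (Λ := Λ) n M) (h1 : star φ ⬝ᵥ φ = 1) :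
    lowestEnergyInSector n (xxzHamiltonian n G J Δ) M ≤ (star φ ⬝ᵥ (xxzHamiltonian n G J Δ *ᵥ φ)).re := by
  have := minEnergyOn_mul_le_re_rayleigh (xxzHamiltonian_isHermitian n G J Δ) (spinZSector (Λ := Λ) n M) hφ
  rw [h1, Complex.one_re, mul_one] at this
  exact this

/-- **THEOREM V (Hellmann–Feynman monotonicity, finite form).** Along the XXZ pencil the Ising part
of the energy of the sector ground state is non-increasing: for `Δ₁ < Δ₂` and normalised sector
ground states `ψᵢ` of `H(Δᵢ)` in the same sector, `Re⟨ψ₂, (H(1)−H(0))ψ₂⟩ ≤ Re⟨ψ₁, (H(1)−H(0))ψ₁⟩`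
(any finite graph, any spin, any magnetisation, either sign of `J`; no uniqueness needed).  For
`J = −1` this says `Σ_E⟨Sᶻ_xSᶻ_y⟩` is non-decreasing in `Δ`. [folklore] -/
theorem sectorGS_isingEnergy_antitone {J M Δ₁ Δ₂ : ℝ} (h12 : Δ₁ < Δ₂)
    {ψ₁ ψ₂ : TensorIndex Λ (n + 1) → ℂ}
    (g₁m : ψ₁ ∈ spinZSector (Λ := Λ) n M) (g₁n : star ψ₁ ⬝ᵥ ψ₁ = 1)
    (g₁e : xxzHamiltonian n G J Δ₁ *ᵥ ψ₁ =
      ((lowestEnergyInSector n (xxzHamiltonian n G J Δ₁) M : ℝ) : ℂ) • ψ₁)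
    (g₂m : ψ₂ ∈ spinZSector (Λ := Λ) n M) (g₂n : star ψ₂ ⬝ᵥ ψ₂ = 1)
    (g₂e : xxzHamiltonian n G J Δ₂ *ᵥ ψ₂ =
      ((lowestEnergyInSector n (xxzHamiltonian n G J Δ₂) M : ℝ) : ℂ) • ψ₂) :
    (star ψ₂ ⬝ᵥ ((xxzHamiltonian n G J 1 - xxzHamiltonian n G J 0) *ᵥ ψ₂)).re ≤
      (star ψ₁ ⬝ᵥ ((xxzHamiltonian n G J 1 - xxzHamiltonian n G J 0) *ᵥ ψ₁)).re := by
  have v1 := sectorEnergy_le_re_form n G (J := J) (Δ := Δ₁) g₂m g₂n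
  have v2 := sectorEnergy_le_re_form n G (J := J) (Δ := Δ₂) g₁m g₁n
  rw [← re_form_of_sectorGS n G g₁n g₁e, re_form_affine, re_form_affine n G J Δ₁ ψ₂] at v1
  rw [← re_form_of_sectorGS n G g₂n g₂e, re_form_affine, re_form_affine n G J Δ₂ ψ₁] at v2
  -- `(Δ₂ - Δ₁) · (b₂ - b₁) ≤ 0`
  have key : (Δ₂ - Δ₁) * (star ψ₂ ⬝ᵥ ((xxzHamiltonian n G J 1 - xxzHamiltonian n G J 0) *ᵥ ψ₂)).re
      ≤ (Δ₂ - Δ₁) * (star ψ₁ ⬝ᵥ ((xxzHamiltonian n G J 1 - xxzHamiltonian n G J 0) *ᵥ ψ₁)).re := by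
    nlinarith
  exact le_of_mul_le_mul_left key (sub_pos.2 h12)

/-- **THEOREM V (energy form).** For `Δ₁ < Δ₂ ≤ Δ⋆` the `H(Δ⋆)`-energy of the sector ground state is
non-increasing from `Δ₁` to `Δ₂`: `Re⟨ψ₂, H(Δ⋆)ψ₂⟩ ≤ Re⟨ψ₁, H(Δ⋆)ψ₁⟩`.  With `Δ⋆ = 1`, `J = −1`: the
ferromagnetic Heisenberg energy of the XXZ sector ground state decreases as `Δ ↑ 1`, on every graph.
[folklore] -/
theorem sectorGS_energyAt_antitone {J M Δ₁ Δ₂ Δs : ℝ} (h12 : Δ₁ < Δ₂) (h2s : Δ₂ ≤ Δs)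
    {ψ₁ ψ₂ : TensorIndex Λ (n + 1) → ℂ}
    (g₁m : ψ₁ ∈ spinZSector (Λ := Λ) n M) (g₁n : star ψ₁ ⬝ᵥ ψ₁ = 1)
    (g₁e : xxzHamiltonian n G J Δ₁ *ᵥ ψ₁ =
      ((lowestEnergyInSector n (xxzHamiltonian n G J Δ₁) M : ℝ) : ℂ) • ψ₁)
    (g₂m : ψ₂ ∈ spinZSector (Λ := Λ) n M) (g₂n : star ψ₂ ⬝ᵥ ψ₂ = 1)
    (g₂e : xxzHamiltonian n G J Δ₂ *ᵥ ψ₂ =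
      ((lowestEnergyInSector n (xxzHamiltonian n G J Δ₂) M : ℝ) : ℂ) • ψ₂) :
    (star ψ₂ ⬝ᵥ (xxzHamiltonian n G J Δs *ᵥ ψ₂)).re ≤ (star ψ₁ ⬝ᵥ (xxzHamiltonian n G J Δs *ᵥ ψ₁)).re := by
  have hb := sectorGS_isingEnergy_antitone n G h12 g₁m g₁n g₁e g₂m g₂n g₂e
  have v2 := sectorEnergy_le_re_form n G (J := J) (Δ := Δ₂) g₁m g₁n
  rw [← re_form_of_sectorGS n G g₂n g₂e, re_form_affine, re_form_affine n G J Δ₂ ψ₁] at v2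
  rw [re_form_affine n G J Δs ψ₂, re_form_affine n G J Δs ψ₁]
  nlinarith [mul_nonneg (sub_nonneg.2 h2s) (sub_nonneg.2 hb)]

/-- The mirror statement below the pencil point: for `Δ⋆ ≤ Δ₁ < Δ₂`,
`Re⟨ψ₁, H(Δ⋆)ψ₁⟩ ≤ Re⟨ψ₂, H(Δ⋆)ψ₂⟩`. [folklore] -/
theorem sectorGS_energyAt_monotone {J M Δ₁ Δ₂ Δs : ℝ} (h12 : Δ₁ < Δ₂) (hs1 : Δs ≤ Δ₁)
    {ψ₁ ψ₂ : TensorIndex Λ (n + 1) → ℂ}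
    (g₁m : ψ₁ ∈ spinZSector (Λ := Λ) n M) (g₁n : star ψ₁ ⬝ᵥ ψ₁ = 1)
    (g₁e : xxzHamiltonian n G J Δ₁ *ᵥ ψ₁ =
      ((lowestEnergyInSector n (xxzHamiltonian n G J Δ₁) M : ℝ) : ℂ) • ψ₁)
    (g₂m : ψ₂ ∈ spinZSector (Λ := Λ) n M) (g₂n : star ψ₂ ⬝ᵥ ψ₂ = 1)
    (g₂e : xxzHamiltonian n G J Δ₂ *ᵥ ψ₂ =
      ((lowestEnergyInSector n (xxzHamiltonian n G J Δ₂) M : ℝ) : ℂ) • ψ₂) :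
    (star ψ₁ ⬝ᵥ (xxzHamiltonian n G J Δs *ᵥ ψ₁)).re ≤ (star ψ₂ ⬝ᵥ (xxzHamiltonian n G J Δs *ᵥ ψ₂)).re := by
  have hb := sectorGS_isingEnergy_antitone n G h12 g₁m g₁n g₁e g₂m g₂n g₂e
  have v1 := sectorEnergy_le_re_form n G (J := J) (Δ := Δ₁) g₂m g₂n
  rw [← re_form_of_sectorGS n G g₁n g₁e, re_form_affine, re_form_affine n G J Δ₁ ψ₂] at v1
  rw [re_form_affine n G J Δs ψ₂, re_form_affine n G J Δs ψ₁]
  nlinarith [mul_nonneg (sub_nonneg.2 hs1) (sub_nonneg.2 hb)]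

/-! ### Theorem VI, block form (theory seat `hubbard-h0-rotor-theory-1`, cycle 4)

On a set `K` of vectors on which the total-spin Casimir is an affine, non-increasing function of the
isotropic energy, `Re⟨ψ, 𝐒² ψ⟩ = c − a·Re⟨ψ, H(1) ψ⟩` with `a ≥ 0` (the model case: the symmetric block of
a complete equipartite graph `K_{m,…,m}`, where `H(1) = −Σ_E 𝐒_x·𝐒_y = −½𝐒²_tot + ½Σ_parts 𝐒_a²` and each
`𝐒_a²` is constant), Theorem V at the pencil point `Δ⋆ = 1` gives the monotonicity of `⟨𝐒²⟩` along the
sector ground states for ALL `Δ₁ < Δ₂ ≤ 1` and every sector.  The "block step" (that the sector ground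
states lie in `K`, by Perron–Frobenius and the automorphism group) is the hypothesis `k₁, k₂`. -/

/-- **Theorem VI, block form**: if two normalised sector ground states at anisotropies `Δ₁ < Δ₂ ≤ 1`
lie in a set `K` on which `Re⟨ψ, 𝐒² ψ⟩ = c − a · Re⟨ψ, H(1) ψ⟩` with `a ≥ 0`, then
`⟨𝐒²⟩_{ψ₁} ≤ ⟨𝐒²⟩_{ψ₂}` (from `sectorGS_energyAt_antitone` with `Δ⋆ = 1`). [folklore] -/
theorem casimir_monotone_of_block {J M Δ₁ Δ₂ c a : ℝ} (ha : 0 ≤ a) (h12 : Δ₁ < Δ₂) (h2 : Δ₂ ≤ 1)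
    (K : Set (TensorIndex Λ (n + 1) → ℂ))
    (hK : ∀ ψ ∈ K, (star ψ ⬝ᵥ (totalSpinSq (Λ := Λ) n *ᵥ ψ)).re
        = c - a * (star ψ ⬝ᵥ (xxzHamiltonian n G J 1 *ᵥ ψ)).re)
    {ψ₁ ψ₂ : TensorIndex Λ (n + 1) → ℂ}
    (g₁m : ψ₁ ∈ spinZSector (Λ := Λ) n M) (g₁n : star ψ₁ ⬝ᵥ ψ₁ = 1)
    (g₁e : xxzHamiltonian n G J Δ₁ *ᵥ ψ₁ =
      ((lowestEnergyInSector n (xxzHamiltonian n G J Δ₁) M : ℝ) : ℂ) • ψ₁)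
    (g₂m : ψ₂ ∈ spinZSector (Λ := Λ) n M) (g₂n : star ψ₂ ⬝ᵥ ψ₂ = 1)
    (g₂e : xxzHamiltonian n G J Δ₂ *ᵥ ψ₂ =
      ((lowestEnergyInSector n (xxzHamiltonian n G J Δ₂) M : ℝ) : ℂ) • ψ₂)
    (k₁ : ψ₁ ∈ K) (k₂ : ψ₂ ∈ K) :
    (star ψ₁ ⬝ᵥ (totalSpinSq (Λ := Λ) n *ᵥ ψ₁)).re ≤ (star ψ₂ ⬝ᵥ (totalSpinSq (Λ := Λ) n *ᵥ ψ₂)).re := by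
  have hE := sectorGS_energyAt_antitone n G h12 h2 g₁m g₁n g₁e g₂m g₂n g₂e
  rw [hK ψ₁ k₁, hK ψ₂ k₂]
  nlinarith [mul_le_mul_of_nonneg_left hE ha]

/-- **Theorem VI, whole-sector form**: if the affine Casimir identity holds on the whole sector
`spinZSector n M` (no block step needed — e.g. when the identity is an operator identity on the sector),
then `⟨𝐒²⟩` is non-decreasing along normalised sector ground states for all `Δ₁ < Δ₂ ≤ 1`. [folklore] -/
theorem casimir_monotone_of_sector {J M Δ₁ Δ₂ c a : ℝ} (ha : 0 ≤ a) (h12 : Δ₁ < Δ₂) (h2 : Δ₂ ≤ 1)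
    (hK : ∀ ψ ∈ spinZSector (Λ := Λ) n M, (star ψ ⬝ᵥ (totalSpinSq (Λ := Λ) n *ᵥ ψ)).re
        = c - a * (star ψ ⬝ᵥ (xxzHamiltonian n G J 1 *ᵥ ψ)).re)
    {ψ₁ ψ₂ : TensorIndex Λ (n + 1) → ℂ}
    (g₁m : ψ₁ ∈ spinZSector (Λ := Λ) n M) (g₁n : star ψ₁ ⬝ᵥ ψ₁ = 1)
    (g₁e : xxzHamiltonian n G J Δ₁ *ᵥ ψ₁ =
      ((lowestEnergyInSector n (xxzHamiltonian n G J Δ₁) M : ℝ) : ℂ) • ψ₁)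
    (g₂m : ψ₂ ∈ spinZSector (Λ := Λ) n M) (g₂n : star ψ₂ ⬝ᵥ ψ₂ = 1)
    (g₂e : xxzHamiltonian n G J Δ₂ *ᵥ ψ₂ =
      ((lowestEnergyInSector n (xxzHamiltonian n G J Δ₂) M : ℝ) : ℂ) • ψ₂) :
    (star ψ₁ ⬝ᵥ (totalSpinSq (Λ := Λ) n *ᵥ ψ₁)).re ≤ (star ψ₂ ⬝ᵥ (totalSpinSq (Λ := Λ) n *ᵥ ψ₂)).re :=
  casimir_monotone_of_block n G ha h12 h2 (spinZSector (Λ := Λ) n M : Set (TensorIndex Λ (n + 1) → ℂ))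
    hK g₁m g₁n g₁e g₂m g₂n g₂e g₁m g₂m

end Summit.HubbardSuperconductivity.HubbardSuperconductivity.Theorems.AnisotropyChord
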